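import Summits.BirchSwinnertonDyer.Rank1Residual.Additive.ChiBranchRatLowerDvd
import Summits.BirchSwinnertonDyer.Rank1Residual.Additive.GordChiBranchWuthrichComponent
import Summits.BirchSwinnertonDyer.Rank1Residual.Additive.X3RatMainConjLowerBound
import Literature.NumberTheory.EllipticCurves.Wuthrich2014.ReducibleDivisibilityCyclotomicPrimeComponentOfHalf
import HarnessLib

/-!
# ENDS over the one-sided rational Skinner–Urban containment `ChiBranchRatLowerDvdAt` (EVEN branch,
# `p ≡ 1 (mod 4)`) on the REDUCIBLE rows (X3): Wuthrich's printed half (Thm. 16, no image hypothesis)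
# upgrades the node to `ChiBranchRatCharEqAt`, and the X3♯(G-ord) ∩ `I₀*` ends at `p ≥ 5`
# (cell `b2b-bsdres`, team n1011, seat n1011-p06 gen 2, OWNERS row T-N10R, phase 4, even-node ENDS sibling)

HONEST FRAMING (cell `b2b-bsdres`, run/shared/lean/b2b/bsd-rank1-residual/, verbatim in every
file): the goal of the cell is to DELETE the COMBINATION-SHAPED residual classes of the
Birch–Swinnerton-Dyer formula for ALL analytic-rank `≤ 1` elliptic curves over `ℚ` — "full BSD
formula for every rank `≤ 1` curve in class `C`" assembled STRICTLY from published theorems — so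
that the rank-`≤ 1` remainder becomes exactly the CONSTRUCTION-SHAPED classes, which are TYPED
(missing-input `Prop`s), NOT attempted. This is not "finishing BSD". Team n1011 (X4 ∧ `p = 3` / the
additive block, §I items N10 / N11): research routes; prove what is provable now; no claim beyond
the stated classes; X3♯(G-ord) stays CONSTRUCTION-SHAPED; labels / census / located gap UNCHANGED;
nothing is booked. Theorems only (no definition, no named fact minted; the Literature inputs are the
explicit binders `hWu` = Wuthrich 2014 Thm. 16 half-eigenspace reading, `hDel`, `hDel98`, `hPal`).

## What and why

Even twin of `ChiBranchRatLowerDvdOddEnds.lean` §B (same seat): `ChiBranchRatLowerDvd.lean` (p253092)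
upgraded the typed one-sided RATIONAL containment `ChiBranchRatLowerDvdAt W p` (even branch of the
good-ordinary twist, `p ≡ 1 (mod 4)`) to the rational equality `ChiBranchRatCharEqAt W p` on the
IRREDUCIBLE rows by Kato's half. On the REDUCIBLE rows (`Red W p`, class X3) the printed half is
Wuthrich 2014 Thm. 16 (general half-eigenspace form `Wuthrich2014.thm16_halfEigenCharIdeal_dvd_cyclotomicPrime`
via `Wuthrich2014.charIdeal_dvd_padicLFunctionBranch_component_of_half`), transported to `X(W/ℚ_∞)` as
in additive-p2's even reducible Brick 5′ (`chiBranchLeadingTermAt_of_wuthrichComponent`, which exported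
only the `T = 0` shadow). NO image or tower hypothesis. So:

* §1 `exists_mem_charIdeal_map_eq_unit_mul_branch_of_wuthrichHalf` — Wuthrich's half on `X(W/ℚ_∞)` as
  a full power-series identity, even branch;
* §2 `chiBranchRatCharEqAt_of_wuthrichHalf_of_ratLowerDvd` — on `Red W p ∧ 0 ≤ ord_p j(W)`:
  `ChiBranchRatLowerDvdAt W p` ⟹ `ChiBranchRatCharEqAt W p` (`exists_span_eq_and_map_eq_C_zpow_mul`);
* §3 X3♯(G-ord) ∩ `I₀*`, `p ≥ 5`, `p ≡ 1 (mod 4)`, `r_an = 0`, non-CM, non-anomalous: the LOWER half and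
  `BSD(E,p)` ⟸ `ChiBranchRatLowerDvdAt W p` + ONE unit coefficient + printed facts (p251406's
  `ClassX3Gord.…_of_ratCharEq_of_unitCoeff[_of_wuthrichHalf]`), no image hypothesis anywhere.

X3♯(G-ord) stays CONSTRUCTION-SHAPED; nothing booked; no label change.

References: C. Wuthrich, J. London Math. Soc. 90 (2014) Thm. 16 (p. 397), §3 (p. 390) [Wuthrich2014];
C. Skinner, E. Urban, Invent. Math. 195 (2014) Cor. 3.6.2 (p. 42), Thm. 3.6.4 (p. 43) [SkinnerUrban2014];
Mazur–Tate–Teitelbaum, Invent. Math. 84 (1986) §I.12–I.14 [MazurTateTeitelbaum1986Invent];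
R. Greenberg, LNM 1716 (1999) §5 (p. 143) [GreenbergLNM1716]; A. Pal, Proc. AMS (2012) Thm. 3.2
[Pal2012]; D. Delbourgo, J. Number Theory 95 (2002) Theorem (A), (B) (p. 40) [Delbourgo2002];
D. Delbourgo, Compositio Math. 113 (1998) Prop. 4 (p. 144) [Delbourgo1998]; R. L. Miller, LMS J.
Comput. Math. 14 (2011) Def. 1.1 [Miller2011LMS].
-/

noncomputable section

open scoped Classical MatrixGroups ModularForm NumberField

open CongruenceSubgroup WeierstrassCurve NumberField Literature.NumberTheory.EllipticCurves
  Literature.NumberTheory.EllipticCurves.ModularForms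
  Literature.NumberTheory.EllipticCurves.Rank1Residual
  Literature.NumberTheory.EllipticCurves.Rank1Residual.Typed
  Literature.NumberTheory.GaloisRepresentations
  IsDedekindDomain

namespace Summit.BirchSwinnertonDyer.Rank1Residual.Additive

open AdditivePotMult

/-! ### §1 Wuthrich's half on `X(E/ℚ_∞)`, even branch — the full series -/

section WuthrichHalf

variable (W : WeierstrassCurve ℚ) [W.IsElliptic] (p : ℕ) [hp : Fact p.Prime]

/-- **Wuthrich's half of the even-branch main conjecture, on the additive curve's `X(E/ℚ_∞)`, as a power
series identity (reducible `E[p]`).** For `W/ℚ` potentially good at `p ≡ 1 (mod 4)` (`0 ≤ ord_p j(W)`)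
with `W[p]` REDUCIBLE, every globally minimal `V`, good ordinary or multiplicative at `p` (the
multiplicative case is vacuous), with `C • V^{(p)} = W`, every cyclotomic `κ/γ` matching the cyclotomic
variable, newform `f` of `V`, `Λ`-dual datum `D` of `Sel_{p^∞}(W/ℚ_∞)` and `ϖ · Ω_V = Ω⁺_f`: `X(W/ℚ_∞)`
is `Λ`-torsion and some `g ∈ char_Λ X(W/ℚ_∞)` has `ι g = u · ϖ · L_p(f, α, ω^{(p−1)/2}, T)`, `u ∈ ℤ_pˣ`.
No image hypothesis (additive-p2's even reducible Brick 5′ stopped BEFORE the constant term, over `hWu`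
via `…_component_of_half`). [cite: Wuthrich2014, Thm. 16 (p. 397), §3 (p. 390)]
[cite: GreenbergLNM1716, §5 p. 143] [cite: MazurTateTeitelbaum1986Invent, §I.13] -/
theorem exists_mem_charIdeal_map_eq_unit_mul_branch_of_wuthrichHalf
    (hWu : Wuthrich2014.thm16_halfEigenCharIdeal_dvd_cyclotomicPrime)
    (hj : 0 ≤ padicValRat p W.j) (hredW : Red W p)
    (V : WeierstrassCurve ℚ) [V.IsElliptic] [V.IsGloballyMinimal]
    {κ : ZpExtension ℚ p} {γ : Field.absoluteGaloisGroup ℚ} {N : ℕ} [NeZero N]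
    {f : CuspForm (Gamma0 N) 2} (hp1 : p % 4 = 1)
    (hCW : ∃ C : VariableChange ℚ, C • V.quadraticTwist (p : ℚ) = W) (hred : GoodOrd V p ∨ Mult V p)
    (hκ : κ.IsCyclotomic) (hγ : κ.IsTopGenerator γ) (hcv : IsCyclotomicVariable p γ)
    (hf : IsNewformOf V f) (D : W.SelmerDualData κ γ) (ϖ : ℚ)
    (hϖ : (ϖ : ℝ) * V.realPeriodRat = plusPeriod f) :
    D.IsTorsion ∧ ∃ g ∈ D.charIdeal, ∃ u : ℤ_[p]ˣ,
      iwasawaToPowerSeries p g =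
        PowerSeries.C (((u : ℤ_[p]) : ℚ_[p]) * (ϖ : ℚ_[p])) *
          padicLFunctionBranch f (unitRoot V p : ℚ_[p]) (p / 2) := by
  have hK := Wuthrich2014.charIdeal_dvd_padicLFunctionBranch_component_of_half hWu
  have hp2 : p ≠ 2 := by rintro rfl; norm_num at hp1
  have hpne : (p : ℚ) ≠ 0 := Nat.cast_ne_zero.mpr hp.out.ne_zero
  have heven : Even (p / 2) := ⟨p / 4, by omega⟩
  have hord : IsOrdinaryAt V p := isOrdinaryAt_of_goodOrd_or_mult_of_model_twist W V hpne hCW hj hred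
  obtain ⟨C, hC⟩ := hCW
  haveI hcycL : IsCyclotomicExtension {p} ℚ (CyclotomicField p ℚ) := by
    have h : (CyclotomicField.algebra p ℚ : Algebra ℚ (CyclotomicField p ℚ)) =
        DivisionRing.toRatAlgebra := Subsingleton.elim _ _
    exact h ▸ CyclotomicField.isCyclotomicExtension p ℚ
  obtain ⟨K, θ, hK2, hθ, hθ2⟩ := exists_intermediateField_sq_eq_pStar p (CyclotomicField p ℚ) hp2
  haveI : NumberField K := NumberField.of_module_finite ℚ K
  have hcK : θ ^ 2 = algebraMap ℚ K (p : ℚ) := by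
    rw [hθ2, pStar_eq_self_of_mod_four_eq_one hp1]
  haveI : IsGalois ℚ K := isGalois_of_finrank_eq_two K hK2
  haveI := normal_galRange K hK2 (sigmaQ_ne_one K hK2 hθ hcK)
  haveI := normal_galRange_cyclotomic p (CyclotomicField p ℚ)
  haveI : (V.quadraticTwist (p : ℚ)).IsElliptic := V.isElliptic_quadraticTwist hpne
  obtain ⟨γ', hγ'KF, hκγ', ⟨g₀, hg₀, hγ'eq⟩, D', hchar, htor⟩ :=
    SelmerDualData.exists_chiEigenInCyclotomic p (CyclotomicField p ℚ) V K hK2 hθ hcK κ hC hp2 D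
  obtain ⟨htorX, g, hgmem, u, hιg⟩ := hK p V K (CyclotomicField p ℚ) (κ := κ) (γ := γ') (f := f)
    (chiEigenSelmerIn V K p κ (galRange (K := ℚ) (CyclotomicField p ℚ)))
    (fun t ht ↦ conjH1_mem_chiEigenSelmerIn γ' ht) D'.X D'.toDual hp2 hK2 ⟨θ, hθ2⟩ hord
    (fun hV ↦ hredW ((irr_iff_of_model_twist (W := V) (p := p) hpne ⟨C, hC⟩).mpr hV)) hκ
    (isTopGenerator_of_kappa_eq κ hκγ' hγ)
    (isCyclotomicVariable_of_eq_mul p κ hκ hg₀ hγ'eq hcv)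
    (Subgroup.mem_inf.mp hγ'KF).1 (Subgroup.mem_inf.mp hγ'KF).2 hf
    (mem_chiEigenSelmerIn_iff_ite V K κ _) D'.bijective D'.toDual_T_smul D'.toDual_C_smul ϖ
    (by rw [if_pos heven]; exact hϖ)
  refine ⟨htor.mp htorX, g, hchar ▸ hgmem, u, ?_⟩
  rw [hιg, if_pos heven]

end WuthrichHalf

/-! ### §2 The split on the reducible rows, even branch -/

section Split

variable {W : WeierstrassCurve ℚ} [W.IsElliptic] {p : ℕ} [hp : Fact p.Prime]

/-- **Wuthrich's printed half + the typed RATIONAL Skinner–Urban containment ⟹ the rational even-branch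
main conjecture `ChiBranchRatCharEqAt W p`, on the REDUCIBLE rows — no image hypothesis** (`W/ℚ` with
`0 ≤ ord_p j(W)` and `W[p]` reducible; two divisibilities in `Λ ⊗ ℚ_p`, `exists_span_eq_and_map_eq_C_zpow_mul`).
[cite: Wuthrich2014, Thm. 16 (p. 397)] [cite: SkinnerUrban2014, Thm. 3.6.4, proof (p. 43)] -/
theorem chiBranchRatCharEqAt_of_wuthrichHalf_of_ratLowerDvd
    (hWu : Wuthrich2014.thm16_halfEigenCharIdeal_dvd_cyclotomicPrime)
    (hj : 0 ≤ padicValRat p W.j) (hredW : Red W p) (hE : ChiBranchRatLowerDvdAt W p) :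
    ChiBranchRatCharEqAt W p := by
  intro V _ _ κ γ N _ f hp1 hCW hV hκ hγ hcv hf D ϖ hϖ
  obtain ⟨htor, g₁, hg₁, u, hιg₁⟩ :=
    exists_mem_charIdeal_map_eq_unit_mul_branch_of_wuthrichHalf W p hWu hj hredW V hp1 hCW (Or.inl hV)
      hκ hγ hcv hf D ϖ hϖ
  obtain ⟨g, hchar, -⟩ := exists_charIdeal_eq_span_singleton p D
  obtain ⟨G, m, n, hG, hιG⟩ := hE V hp1 hCW hV hκ hγ hcv hf D ϖ hϖ g
    (by rw [hchar]; exact Ideal.mem_span_singleton_self g)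
  have hg₁' : PowerSeries.C ((u⁻¹ : ℤ_[p]ˣ) : ℤ_[p]) * g₁ ∈ Ideal.span {g} := by
    rw [← hchar]; exact Ideal.mul_mem_left _ _ hg₁
  have hCu : iwasawaToPowerSeries p (PowerSeries.C ((u⁻¹ : ℤ_[p]ˣ) : ℤ_[p])) =
      PowerSeries.C ((((u⁻¹ : ℤ_[p]ˣ) : ℤ_[p]) : ℚ_[p])) := by
    rw [PowerSeries.map_C, PadicInt.algebraMap_apply]
  have hu0 : (((u : ℤ_[p]) : ℚ_[p])) ≠ 0 := by
    intro h0
    have h1 : (((u⁻¹ : ℤ_[p]ˣ) : ℤ_[p]) : ℚ_[p]) * (((u : ℤ_[p]) : ℚ_[p])) = 1 := by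
      rw [← PadicInt.coe_mul, Units.inv_mul, PadicInt.coe_one]
    rw [h0, mul_zero] at h1
    exact zero_ne_one h1
  have hιg₁' : iwasawaToPowerSeries p (PowerSeries.C ((u⁻¹ : ℤ_[p]ˣ) : ℤ_[p]) * g₁) =
      PowerSeries.C ((p : ℚ_[p]) ^ (0 : ℕ)) *
        (PowerSeries.C (ϖ : ℚ_[p]) * padicLFunctionBranch f (unitRoot V p : ℚ_[p]) (p / 2)) := by
    rw [pow_zero, map_one, one_mul, map_mul, hιg₁, hCu, ← mul_assoc, ← map_mul, coe_units_inv_eq_inv,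
      ← mul_assoc, inv_mul_cancel₀ hu0, one_mul]
  obtain ⟨g', k, hspan, hιg'⟩ := exists_span_eq_and_map_eq_C_zpow_mul p hg₁' hιg₁' hG hιG
  refine ⟨htor, g', k, hchar.trans hspan, ?_⟩
  rw [hιg', map_mul, mul_assoc]

/-- **X3♯(G-ord) (`Red W p`, type (G)-ordinary), `p ≡ 1 (mod 4)`: the rational even-branch main
conjecture from its Skinner–Urban half**, no image hypothesis.
[cite: Wuthrich2014, Thm. 16 (p. 397)] [cite: SkinnerUrban2014, Thm. 3.6.4, proof (p. 43)] -/
theorem ClassX3Gord.chiBranchRatCharEqAt_of_ratLowerDvd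
    (hWu : Wuthrich2014.thm16_halfEigenCharIdeal_dvd_cyclotomicPrime)
    (hX : ClassX3Gord W p) (hE : ChiBranchRatLowerDvdAt W p) : ChiBranchRatCharEqAt W p :=
  chiBranchRatCharEqAt_of_wuthrichHalf_of_ratLowerDvd hWu (padicValRat_j_nonneg_of_typeGOrd W p hX.typeGOrd)
    hX.classX3.1 hE

end Split

/-! ### §3 X3♯(G-ord) ∩ `I₀*`, `p ≥ 5`, `p ≡ 1 (mod 4)`: ends over `ChiBranchRatLowerDvdAt W p` + ONE unit coefficient -/

section Ends

variable {W : WeierstrassCurve ℚ} [W.IsElliptic] [W.IsGloballyMinimal] {p : ℕ} [hp : Fact p.Prime]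

/-- **X3♯(G-ord) ∩ `I₀*` ∩ non-anomalous, `p ≥ 5`, `p ≡ 1 (mod 4)`, non-CM, `r_an = 0`: the LOWER half
`ord_p #Ш_an ≤ ord_p #Ш` ⟸ `ChiBranchRatLowerDvdAt W p` + ONE unit coefficient** (+ Wuthrich's half
`hWu`, Pal `hPal`, Delbourgo 2002 `hDel`, GZK, modularity; p251406's
`ClassX3Gord.missingLowerBoundAt_rankZero_of_ratCharEq_of_unitCoeff`). No image hypothesis.
X3♯(G-ord) stays CONSTRUCTION-SHAPED. [cite: Wuthrich2014, Thm. 16 (p. 397)]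
[cite: Delbourgo2002, Theorem (A), (B) (p. 40)] [cite: Pal2012, Thm. 3.2] [cite: Miller2011LMS, Def. 1.1] -/
theorem ClassX3Gord.missingLowerBoundAt_rankZero_of_ratLowerDvd_of_unitCoeff
    (hWu : Wuthrich2014.thm16_halfEigenCharIdeal_dvd_cyclotomicPrime)
    (hDel : Delbourgo2002.mainTheorem)
    (hPal : Pal2012.thm32_sqrt_mul_realPeriodRat_twist_eq_of_prime_one_mod_four)
    (hGZK : rank_eq_analyticRank_of_analyticRank_le_one) (hmod : hasEntireLFunction_rat)
    (hmodD : nonempty_modularParametrizationData)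
    (hX : ClassX3Gord W p) (he : semistabilityIndex W p = 2) (hp5 : 5 ≤ p) (hp4 : p % 4 = 1)
    (hcm : ¬ W.HasCM) (hr : W.analyticRank = 0) (hna : Delbourgo2002.ReductionNonAnomalous W p)
    (hE : ChiBranchRatLowerDvdAt W p)
    (hcert : ∀ (V : WeierstrassCurve ℚ) [V.IsElliptic] [V.IsGloballyMinimal] (C : VariableChange ℚ),
      GoodOrd V p → C • V.quadraticTwist (p : ℚ) = W →
      ∀ {N : ℕ} [NeZero N] (f : CuspForm (Gamma0 N) 2), IsNewformOf V f →
      ∀ ϖ : ℚ, (ϖ : ℝ) * V.realPeriodRat = plusPeriod f →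
      ∃ n : ℕ, ‖PowerSeries.coeff n
        (PowerSeries.C (ϖ : ℚ_[p]) * padicLFunctionBranch f (unitRoot V p : ℚ_[p]) (p / 2))‖ = 1) :
    MissingLowerBoundAt W p :=
  ClassX3Gord.missingLowerBoundAt_rankZero_of_ratCharEq_of_unitCoeff hDel hPal hGZK hmod hmodD hX he hp5
    hp4 hcm hr hna (hX.chiBranchRatCharEqAt_of_ratLowerDvd hWu hE) hcert

/-- **X3♯(G-ord) ∩ `I₀*` ∩ non-anomalous, `p ≥ 5`, `p ≡ 1 (mod 4)`, non-CM, `r_an = 0`: `BSD(E,p)` ⟸ the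
ONE-SIDED rational Skinner–Urban containment on the even branch (`ChiBranchRatLowerDvdAt W p`, typed) +
ONE unit coefficient, and NOTHING ELSE typed — no image hypothesis anywhere**: Wuthrich's half `hWu`
serves BOTH the upgrade (§2) and the UPPER half (p251406's
`ClassX3Gord.bsdp_rankZero_of_ratCharEq_of_unitCoeff_of_wuthrichHalf`). Nothing booked; X3♯(G-ord)
stays CONSTRUCTION-SHAPED. [cite: Wuthrich2014, Thm. 16 (p. 397)]
[cite: SkinnerUrban2014, Cor. 3.6.2 (p. 42) (shape only)] [cite: Delbourgo2002, Theorem (A), (B) (p. 40)]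
[cite: Delbourgo1998, Prop. 4 (p. 144)] [cite: Pal2012, Thm. 3.2] [cite: Miller2011LMS, §1 and Def. 1.1] -/
theorem ClassX3Gord.bsdp_rankZero_of_ratLowerDvd_of_unitCoeff
    (hWu : Wuthrich2014.thm16_halfEigenCharIdeal_dvd_cyclotomicPrime)
    (hDel : Delbourgo2002.mainTheorem)
    (hDel98 : Delbourgo1998.prop4_rankZero_pow_dvd_constantCoeff)
    (hPal : Pal2012.thm32_sqrt_mul_realPeriodRat_twist_eq_of_prime_one_mod_four)
    (hGZK : rank_eq_analyticRank_of_analyticRank_le_one) (hmod : hasEntireLFunction_rat)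
    (hmodD : nonempty_modularParametrizationData)
    (hX : ClassX3Gord W p) (he : semistabilityIndex W p = 2) (hp5 : 5 ≤ p) (hp4 : p % 4 = 1)
    (hcm : ¬ W.HasCM) (hr : W.analyticRank = 0) (hna : Delbourgo2002.ReductionNonAnomalous W p)
    (hE : ChiBranchRatLowerDvdAt W p)
    (hcert : ∀ (V : WeierstrassCurve ℚ) [V.IsElliptic] [V.IsGloballyMinimal] (C : VariableChange ℚ),
      GoodOrd V p → C • V.quadraticTwist (p : ℚ) = W →
      ∀ {N : ℕ} [NeZero N] (f : CuspForm (Gamma0 N) 2), IsNewformOf V f →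
      ∀ ϖ : ℚ, (ϖ : ℝ) * V.realPeriodRat = plusPeriod f →
      ∃ n : ℕ, ‖PowerSeries.coeff n
        (PowerSeries.C (ϖ : ℚ_[p]) * padicLFunctionBranch f (unitRoot V p : ℚ_[p]) (p / 2))‖ = 1) :
    BSDp W p :=
  ClassX3Gord.bsdp_rankZero_of_ratCharEq_of_unitCoeff_of_wuthrichHalf hDel hWu hDel98 hPal hGZK hmod hmodD
    hX he hp5 hp4 hcm hr hna (hX.chiBranchRatCharEqAt_of_ratLowerDvd hWu hE) hcert

end Ends

end Summit.BirchSwinnertonDyer.Rank1Residual.Additive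

end
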